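import Literature.AnabelianGeometry.EtaleTheta.Discharge.Sec2Cor218Cor219AtModelChi
import Literature.AnabelianGeometry.EtaleTheta.SettingModelChiThetaCocycleSec
import Literature.AnabelianGeometry.EtaleTheta.SettingModelChiCyclotomes
import HarnessLib

/-!
# [EtTh] §2 over §1 AT THE RECORD MODEL `ThetaSetting.modelχ p`: THE MONO-THETA ENVIRONMENT AND TOWER OF RECORD
# — Def. 2.13 / Cor. 2.18 (iii) / Cor. 2.18 (iv) (reduction) with EVERY construction binder discharged
# (proof-only, binder-free census; R78 cluster row #5 «§1 → §2 adapter layer», sequel)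

Mochizuki, *The Étale Theta Function and its Frobenioid-theoretic Manifestations* [EtTh], Publ. RIMS **45**
(2009), §2: Def. 2.13 PRIMS PDF p. 47 («mod `N` mono-theta environment» `M_N = (Π_{μ_N}, D_Y, s^Θ_{μ_N})`),
Def. 2.13 (ii) p. 48, Cor. 2.18 (iii) p. 61 («`Π•_X ≅ Π^tp_X`»; the kernel of `Π• ↠ Π•_Y`), Cor. 2.18 (iv) p. 61
(«induces … an isomorphism `M_{M'} → M_M`»), Cor. 2.19 (ii) p. 64 (the natural projective system over a cofinal
totally ordered `E ∋ 1`); §1 Prop. 1.3 p. 20, Prop. 1.5 (i)/(ii) pp. 22–23, Def. 2.5 (i) p. 39 / Def. 2.7 p. 41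
(the choice `X̲̲`) [cite: MochizukiEtTh2009, Def 2.13 p.47].  Cell `abc-iut`, layer L2, seat abc-iut-L2-t8 (gen 6;
owner of the §1 → §2 merge adapter `C.thetaEnvData μ hC hS` / `C.thetaEnvTower τ hC hS` / `C.rigidData …`,
`ThetaEnvOfSetting.lean` / `TowerOfSetting.lean` / `RigidOfSetting.lean`, and of `CyclotomeMod`); R78 cluster
(integrator abc-iut-L6-d6) row #5, the by-name sequel recorded in this seat's gen-5 HANDOFF («E-indexed §2 layer»).
PROOF-ONLY: no definition, no instance, no notation, no new named fact; nothing of another seat is edited or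
restated — every input is consumed BY NAME.

STATE OF RECORD.  abc-iut-f-150's `Sec2Cor218Cor219AtModelChi` proved the `ThetaEnvData` / `ThetaEnvTower`
rows of [EtTh] §2 AT THE RECORD MODEL for EVERY étale-theta datum `E` over `modelχ p`, every `X̲̲`-choice
`C : E.DoubleUnderline l` and every cyclotome identification `μ` / tower `τ` — binder set = the construction data
`(E, C, μ / τ)` («DATA-ONLY census forms» `thetaEnvData_cor218_iii_modelχ_holds`, `cor218_iv_reduction_modelχ_holds`).
Since then every item of that construction data has been CONSTRUCTED at `modelχ p`:
* `E := etaleThetaDataχSec p (etaDdχ p)` — abc-iut-L2-t6's SECTION datum (`SettingModelChiSectionPoints`) carrying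
  abc-iut-L2-d1's theta class `η̈^Θ = etaDdχ p ≠ 1` (`SettingModelChiThetaCocycle`), with `Prop13`
  (abc-iut-L2-t6), `Prop15i` / `Prop15ii` (abc-iut-L6-d5) — abc-iut-L2-d1's joint census
  `exists_etaleThetaData_prop13_prop15i_prop15ii_ne_one_doubleUnderline` (`SettingModelChiThetaCocycleSec`);
* `C := doubleUnderlineχSec p l hl : E.DoubleUnderline l` (`l` odd) — abc-iut-L2-d1, all six clauses of
  Def. 2.5 (i) / 2.7 with `Π^tp_X̲̲ = Huuχ p l = dUU l ⋊_χ G_{ℚ_p}` and `eta_res` by `eta_res_thetaCocycleχ`;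
* `μ : (modelχ p).CyclotomeMod l N` at every level and `τ : (modelχ p).CyclotomeTower l E` over every admissible
  chain — this seat's `modelχ_nonempty_cyclotomeMod` / `modelχ_nonempty_cyclotomeTower` (`SettingModelChiCyclotomes`,
  from abc-iut-L6-d6's `Ẑ`-coordinate `deltaThetaCoordχ`);
* `hC := compat_modelχ p` (abc-iut-f-150), `hS := ThetaSetting.modelχ_sec2Hyps p` (abc-iut-L2-d1).

THIS FILE assembles them: the mono-theta environment OF RECORD
`(doubleUnderlineχSec p l hl).thetaEnvData μ (compat_modelχ p) (modelχ_sec2Hyps p) : ThetaEnvData N` and the tower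
OF RECORD `(doubleUnderlineχSec p l hl).thetaEnvTower τ … : ThetaEnvTower E` — built by the adapter from the model's
OWN theta class, `X̲̲` and cyclotomes — satisfy Cor. 2.18 (iii) (F-0636 / F-0637) and Cor. 2.18 (iv), reduction
clause (F-0648), with NO binder left (§1–§2), and the BINDER-FREE census forms (§3): at `modelχ p` — indeed over
SOME theta setting satisfying the §1 guard `IsEtThOrigin` and `Sec2Hyps` — there EXIST an étale-theta datum with
non-trivial `η̈^Θ`, Prop. 1.3, Prop. 1.5 (i), (ii), a choice `X̲̲`, and cyclotome data whose mono-theta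
environment / tower satisfies those rows.  This closes the «E-indexed §2 layer» of the non-vacuity register in
`ThetaEnvData` / `ThetaEnvTower` currency at stage 1.

WHAT IS DELIBERATELY NOT HERE (honesty datum).  The `RigidData`-currency rows (Prop. 2.12, Prop. 2.14, Cor. 2.18
(ii)/(iv) fibres, Cor. 2.19 (i)) take the adapter `C.rigidData μ hC hS h15 L`, whose INPUT `h15 : Prop15iii E hC`
is REFUTED at stage 1 for the whole section family (abc-iut-L2-t12's `SettingModel.not_prop15iii_etaleThetaDataχSec`,
`SettingModelChiProp15iiiSplitNegative`: the split action has no Tate shear) — so at `modelχ` those rows would be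
vacuous and are NOT instantiated; their home is the stage-2 record `modelχq` / `modelTate` (R78 F7q), the twin of
this file.  HONEST LABEL: `modelχ` is a SEMI-SYNTHETIC model of the typed §1 interface (not the tempered `π₁` of a
curve) — consistency / joint-satisfiability evidence only; nothing of [EtTh] is asserted; no side is taken on
[IUTchIII] Cor. 3.12; typed ≠ proved; a FACT row is an assumption label, not an endorsement.
-/

noncomputable section

namespace Literature.AnabelianGeometry.EtaleTheta.SettingModel

open Literature.AnabelianGeometry.SemiGraphs

variable (p : ℕ) [Fact p.Prime] (l : ℕ+) (hl : Odd (l : ℕ)) {N : ℕ+}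
  (μ : (ThetaSetting.modelχ p).CyclotomeMod l N) {Es : Set ℕ+} (τ : (ThetaSetting.modelχ p).CyclotomeTower l Es)

/-! ## §1. The mono-theta environment of record at level `N` (Def. 2.13) and Cor. 2.18 (iii) for it -/

/-- **`Π_X̲̲` of the mono-theta environment of record is `Huuχ p l = dUU l ⋊_χ G_{ℚ_p}`** — Def. 2.13's
"`Π^tp_X̲̲`" instantiated at the record model's own choice `X̲̲` (definitional bookkeeping:
`thetaEnvData_PiX` + abc-iut-L2-d1's `doubleUnderlineχSec_Huu`). [cite: MochizukiEtTh2009, Def 2.13 p.47] -/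
theorem thetaEnvData_modelχSec_PiX :
    ((doubleUnderlineχSec p l hl).thetaEnvData μ (compat_modelχ p) (ThetaSetting.modelχ_sec2Hyps p)).PiX =
      Huuχ p l :=
  rfl

/-- **Cor. 2.18 (iii) HOLDS for the mono-theta environment of record, NO binder** ([EtTh] Cor. 2.18 (iii),
p. 61: `Π•_X ≅ Π^tp_X` and the kernel of `Π• ↠ Π•_Y`; F-0636 `ThetaEnvData.Cor218_iii_PiX`, F-0637
`ThetaEnvData.Cor218_iii_quotient`): abc-iut-f-150's `thetaEnvData_cor218_iii_modelχ_holds` at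
`C := doubleUnderlineχSec p l hl`, for every cyclotome identification `μ` (a non-empty family,
`modelχ_nonempty_cyclotomeMod`). [cite: MochizukiEtTh2009, Cor 2.18(iii) p.61] -/
theorem thetaEnvData_modelχSec_cor218_iii :
    Literature.AnabelianGeometry.EtaleTheta.ThetaEnvData.Cor218_iii_PiX
        ((doubleUnderlineχSec p l hl).thetaEnvData μ (compat_modelχ p) (ThetaSetting.modelχ_sec2Hyps p)) ∧
      Literature.AnabelianGeometry.EtaleTheta.ThetaEnvData.Cor218_iii_quotient
        ((doubleUnderlineχSec p l hl).thetaEnvData μ (compat_modelχ p) (ThetaSetting.modelχ_sec2Hyps p)) :=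
  thetaEnvData_cor218_iii_modelχ_holds p (doubleUnderlineχSec p l hl) μ

/-! ## §2. The tower of record over an admissible chain `E ∋ 1` (Def. 2.13 (ii), Cor. 2.19 (ii)) -/

/-- **Cor. 2.18 (iv), reduction clause, HOLDS for the tower of record, NO binder** ([EtTh] Cor. 2.18 (iv),
p. 61: every automorphism of `M_{M'}` induces one of `M_M`, `M ∣ M'`; F-0648 `ThetaEnvTower.Cor218_iv_reduction`):
abc-iut-f-150's `cor218_iv_reduction_modelχ_holds` at `C := doubleUnderlineχSec p l hl`, for every cyclotome tower
`τ` (non-empty over every admissible chain, `modelχ_nonempty_cyclotomeTower`). [cite: MochizukiEtTh2009, Cor 2.18(iv) p.61] -/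
theorem thetaEnvTower_modelχSec_cor218_iv_reduction :
    Literature.AnabelianGeometry.EtaleTheta.ThetaEnvTower.Cor218_iv_reduction
      ((doubleUnderlineχSec p l hl).thetaEnvTower τ (compat_modelχ p) (ThetaSetting.modelχ_sec2Hyps p)) :=
  cor218_iv_reduction_modelχ_holds p (doubleUnderlineχSec p l hl) τ

/-- **Cor. 2.18 (iii) at every level `M ∈ E` of the tower of record, NO binder** (abc-iut-f-150's
`thetaEnvTower_level_cor218_iii_PiX_modelχ` / `_quotient_modelχ` at `C := doubleUnderlineχSec p l hl`).
[cite: MochizukiEtTh2009, Cor 2.18(iii) p.61] -/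
theorem thetaEnvTower_modelχSec_level_cor218_iii (M : Es) :
    Literature.AnabelianGeometry.EtaleTheta.ThetaEnvData.Cor218_iii_PiX
        (((doubleUnderlineχSec p l hl).thetaEnvTower τ (compat_modelχ p) (ThetaSetting.modelχ_sec2Hyps p)).level M) ∧
      Literature.AnabelianGeometry.EtaleTheta.ThetaEnvData.Cor218_iii_quotient
        (((doubleUnderlineχSec p l hl).thetaEnvTower τ (compat_modelχ p) (ThetaSetting.modelχ_sec2Hyps p)).level M) :=
  ⟨thetaEnvTower_level_cor218_iii_PiX_modelχ p (doubleUnderlineχSec p l hl) τ _ _ M,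
    thetaEnvTower_level_cor218_iii_quotient_modelχ p (doubleUnderlineχSec p l hl) τ _ _ M⟩

/-! ## §3. Binder-free census: the E-indexed §2 layer is inhabited with its rows TRUE at the inhabitant -/

include hl in
/-- **BINDER-FREE CENSUS, level `N`, at the record model**: there EXIST an étale-theta datum `E` over `modelχ p`
with `η̈^Θ ≠ 1`, Prop. 1.3, Prop. 1.5 (i), (ii), a choice `X̲̲` (`E.DoubleUnderline l`, `Π^tp_X̲̲ = Huuχ p l`) and a
cyclotome identification `μ_N ≅ (l·Δ_Θ) ⊗ ℤ/N` whose mono-theta environment (Def. 2.13, the §1 → §2 adapter)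
satisfies BOTH clauses of Cor. 2.18 (iii) — witnesses `etaleThetaDataχSec p (etaDdχ p)`, `doubleUnderlineχSec p l hl`,
`modelχ_nonempty_cyclotomeMod`. [cite: MochizukiEtTh2009, Cor 2.18(iii) p.61] -/
theorem exists_thetaEnvData_cor218_iii_modelχ (N : ℕ+) :
    ∃ (E : (ThetaSetting.modelχ p).EtaleThetaData) (C : E.DoubleUnderline l)
      (μ : (ThetaSetting.modelχ p).CyclotomeMod l N),
      E.etaDd ≠ 1 ∧ ThetaSetting.Prop13 E ∧ ThetaSetting.Prop15i E.toKummerData (compat_modelχ p) ∧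
        ThetaSetting.Prop15ii E.toKummerData (compat_modelχ p) ∧ C.Huu = Huuχ p l ∧
          Literature.AnabelianGeometry.EtaleTheta.ThetaEnvData.Cor218_iii_PiX
              (C.thetaEnvData μ (compat_modelχ p) (ThetaSetting.modelχ_sec2Hyps p)) ∧
            Literature.AnabelianGeometry.EtaleTheta.ThetaEnvData.Cor218_iii_quotient
              (C.thetaEnvData μ (compat_modelχ p) (ThetaSetting.modelχ_sec2Hyps p)) := by
  obtain ⟨μ⟩ := modelχ_nonempty_cyclotomeMod p l.pos N
  exact ⟨etaleThetaDataχSec p (etaDdχ p), doubleUnderlineχSec p l hl, μ, etaDdχ_ne_one p,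
    prop13_etaleThetaDataχSec p _, prop15i_kummerDataχSec p _, prop15ii_kummerDataχSec p _, rfl,
    thetaEnvData_modelχSec_cor218_iii p l hl μ⟩

include hl in
/-- **BINDER-FREE CENSUS, tower form, at the record model**: over every index chain `E ∋ 1` cofinal and totally
ordered in `(ℕ≥1, ∣)` there EXIST `E`, `X̲̲` as above and a compatible tower of cyclotome identifications whose
tower of mono-theta environments (Def. 2.13 (ii)) satisfies Cor. 2.18 (iv), reduction clause, and Cor. 2.18 (iii)
at every level — witnesses as above and `modelχ_nonempty_cyclotomeTower`. [cite: MochizukiEtTh2009, Cor 2.18(iv) p.61] -/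
theorem exists_thetaEnvTower_cor218_iii_iv_modelχ (one_mem : (1 : ℕ+) ∈ Es)
    (cofinal : ∀ n : ℕ+, ∃ M ∈ Es, n ∣ M) (total : ∀ M ∈ Es, ∀ M' ∈ Es, M ∣ M' ∨ M' ∣ M) :
    ∃ (E : (ThetaSetting.modelχ p).EtaleThetaData) (C : E.DoubleUnderline l)
      (τ : (ThetaSetting.modelχ p).CyclotomeTower l Es),
      E.etaDd ≠ 1 ∧ ThetaSetting.Prop13 E ∧ ThetaSetting.Prop15i E.toKummerData (compat_modelχ p) ∧
        ThetaSetting.Prop15ii E.toKummerData (compat_modelχ p) ∧ C.Huu = Huuχ p l ∧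
          Literature.AnabelianGeometry.EtaleTheta.ThetaEnvTower.Cor218_iv_reduction
              (C.thetaEnvTower τ (compat_modelχ p) (ThetaSetting.modelχ_sec2Hyps p)) ∧
            ∀ M : Es,
              Literature.AnabelianGeometry.EtaleTheta.ThetaEnvData.Cor218_iii_PiX
                  ((C.thetaEnvTower τ (compat_modelχ p) (ThetaSetting.modelχ_sec2Hyps p)).level M) ∧
                Literature.AnabelianGeometry.EtaleTheta.ThetaEnvData.Cor218_iii_quotient
                  ((C.thetaEnvTower τ (compat_modelχ p) (ThetaSetting.modelχ_sec2Hyps p)).level M) := by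
  obtain ⟨τ⟩ := modelχ_nonempty_cyclotomeTower p l.pos one_mem cofinal total
  exact ⟨etaleThetaDataχSec p (etaDdχ p), doubleUnderlineχSec p l hl, τ, etaDdχ_ne_one p,
    prop13_etaleThetaDataχSec p _, prop15i_kummerDataχSec p _, prop15ii_kummerDataχSec p _, rfl,
    thetaEnvTower_modelχSec_cor218_iv_reduction p l hl τ, thetaEnvTower_modelχSec_level_cor218_iii p l hl τ⟩

include hl in
/-- **BINDER-FREE CENSUS over SOME theta setting with the §1 guard**: there is a theta setting `D` satisfying
`IsEtThOrigin` and `Sec2Hyps` (hence `Compat`) over which an étale-theta datum with `η̈^Θ ≠ 1`, Prop. 1.3,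
Prop. 1.5 (i), (ii), a choice `X̲̲` and a level-`N` cyclotome identification EXIST whose mono-theta environment
satisfies Cor. 2.18 (iii) — the E-indexed §1 → §2 block is JOINTLY non-vacuous together with its first §2 row
(witness `D := modelχ p`). [cite: MochizukiEtTh2009, Cor 2.18(iii) p.61] -/
theorem _root_.Literature.AnabelianGeometry.EtaleTheta.ThetaSetting.exists_isEtThOrigin_thetaEnvData_cor218_iii
    (N : ℕ+) :
    ∃ (D : ThetaSetting p) (_ : D.IsEtThOrigin) (hS : D.Sec2Hyps) (E : D.EtaleThetaData) (C : E.DoubleUnderline l)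
      (μ : D.CyclotomeMod l N),
      E.etaDd ≠ 1 ∧ ThetaSetting.Prop13 E ∧ ThetaSetting.Prop15i E.toKummerData hS.compat ∧
        ThetaSetting.Prop15ii E.toKummerData hS.compat ∧
          Literature.AnabelianGeometry.EtaleTheta.ThetaEnvData.Cor218_iii_PiX (C.thetaEnvData μ hS.compat hS) ∧
            Literature.AnabelianGeometry.EtaleTheta.ThetaEnvData.Cor218_iii_quotient
              (C.thetaEnvData μ hS.compat hS) := by
  obtain ⟨E, C, μ, hne, h13, h15i, h15ii, -, h218⟩ := exists_thetaEnvData_cor218_iii_modelχ p l hl N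
  exact ⟨ThetaSetting.modelχ p, ThetaSetting.modelχ_isEtThOrigin p, ThetaSetting.modelχ_sec2Hyps p, E, C, μ, hne,
    h13, h15i, h15ii, h218⟩

include hl in
/-- **BINDER-FREE CENSUS over SOME theta setting with the §1 guard, tower form**: as above with a compatible
cyclotome tower over any admissible chain `E ∋ 1`, the tower of mono-theta environments satisfying Cor. 2.18 (iv),
reduction clause, and Cor. 2.18 (iii) at every level (witness `D := modelχ p`). [cite: MochizukiEtTh2009, Cor 2.18(iv) p.61] -/
theorem _root_.Literature.AnabelianGeometry.EtaleTheta.ThetaSetting.exists_isEtThOrigin_thetaEnvTower_cor218_iii_iv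
    (one_mem : (1 : ℕ+) ∈ Es) (cofinal : ∀ n : ℕ+, ∃ M ∈ Es, n ∣ M)
    (total : ∀ M ∈ Es, ∀ M' ∈ Es, M ∣ M' ∨ M' ∣ M) :
    ∃ (D : ThetaSetting p) (_ : D.IsEtThOrigin) (hS : D.Sec2Hyps) (E : D.EtaleThetaData) (C : E.DoubleUnderline l)
      (τ : D.CyclotomeTower l Es),
      E.etaDd ≠ 1 ∧ ThetaSetting.Prop13 E ∧ ThetaSetting.Prop15i E.toKummerData hS.compat ∧
        ThetaSetting.Prop15ii E.toKummerData hS.compat ∧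
          Literature.AnabelianGeometry.EtaleTheta.ThetaEnvTower.Cor218_iv_reduction
              (C.thetaEnvTower τ hS.compat hS) ∧
            ∀ M : Es,
              Literature.AnabelianGeometry.EtaleTheta.ThetaEnvData.Cor218_iii_PiX
                  ((C.thetaEnvTower τ hS.compat hS).level M) ∧
                Literature.AnabelianGeometry.EtaleTheta.ThetaEnvData.Cor218_iii_quotient
                  ((C.thetaEnvTower τ hS.compat hS).level M) := by
  obtain ⟨E, C, τ, hne, h13, h15i, h15ii, -, h218iv, h218iii⟩ :=
    exists_thetaEnvTower_cor218_iii_iv_modelχ p l hl one_mem cofinal total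
  exact ⟨ThetaSetting.modelχ p, ThetaSetting.modelχ_isEtThOrigin p, ThetaSetting.modelχ_sec2Hyps p, E, C, τ, hne,
    h13, h15i, h15ii, h218iv, h218iii⟩

end Literature.AnabelianGeometry.EtaleTheta.SettingModel

end
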